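/-
Copyright: literature formalisation for the harness. Statements follow the cited text.
-/
import Literature.AlgebraicGeometry.CossartPiltant200819.Cor13IntegralModels2019
import Literature.AlgebraicGeometry.Motives.VarietiesProperProofs
import Mathlib.AlgebraicGeometry.Limits
import Mathlib.AlgebraicGeometry.Morphisms.Flat
import Mathlib.AlgebraicGeometry.Morphisms.Finite
import Mathlib.CategoryTheory.Limits.VanKampen
import HarnessLib

/-!
# Cossart–Piltant (2019), Corollary 1.3 as printed: non-connected regular projective surfaces

V. Cossart, O. Piltant, *Resolution of singularities of arithmetical threefolds*, J. Algebra
529 (2019) 268–535 (arXiv:1412.0868) [CossartPiltant2019], Cor. 1.3 (§1, arXiv p. 3), verbatim: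
"Let `𝒪` be an excellent Dedekind domain with quotient field `F` and `Σ/F` be a regular
projective surface. There exists a proper and flat `𝒪`-scheme `𝒳` with generic fiber `𝒳_F = Σ`
which is everywhere regular."

The tree's transcription `CP2019.CossartPiltant2019Cor13` (`Projective2019`) carries the extra
hypothesis `IsIntegral S.left` (one connected component of `Σ` at a time), and
`CP2019.cor13_of_thm11` / `CP2019.exists_regularModel_of_thm11` (`Cor13IntegralModels2019`) derive
it from the transcription `CossartPiltant2019Thm11` of Thm. 1.1. This file removes the integrality
hypothesis: `cor13Verbatim_of_thm11` is the printed statement (a regular projective `F`-scheme `Σ`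
of dimension `2`, not assumed connected or integral) derived from `CossartPiltant2019Thm11`, and
`exists_regularModel_of_regular_of_thm11` is the same for dimension `≤ 2`. No new named fact
(`def … : Prop`) is introduced; the printed statement is spelled out in the theorem's type. The
derivation is the disjoint-union assembly:

* a Noetherian regular scheme is the finite disjoint union (coproduct in `Scheme`) of its
  irreducible components, which are open (`Scheme.IsRegular.coe_irreducibleComponentOpen`),
  pairwise disjoint (`Scheme.IsRegular.eq_of_mem_irreducibleComponents`: regular local rings are
  domains) and integral — Stacks Project Tag 033M ("Let `X` be a Noetherian scheme. The following
  are equivalent: (1) `X` is normal, and (2) `X` is a finite disjoint union of normal integral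
  schemes"), in the regular case; Mathlib's `nonempty_isColimit_cofanMk_of` turns the clopen
  cover into a coproduct cocone;
* each component `Σᵢ` is an integral regular projective `F`-scheme of dimension `dᵢ ≤ 2` (a
  surface, a curve or a point), so `exists_regularModel_of_thm11` gives a proper flat regular
  `𝒳ᵢ → Spec 𝒪` with generic fibre `Σᵢ`;
* `𝒳 := ∐ 𝒳ᵢ` is regular (stalks of a coproduct are stalks of the summands), `∐ 𝒳ᵢ → Spec 𝒪`
  is flat (flatness is local at the source) and proper (`Sigma.map` of proper morphisms is proper,
  `sigmaMap_of_isZariskiLocalAtTarget`, and the codiagonal `∐ Spec 𝒪 = Spec 𝒪^n → Spec 𝒪` is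
  finite), and its generic fibre is `∐ (𝒳ᵢ ×_𝒪 F) = ∐ Σᵢ = Σ` because coproducts in `Scheme`
  are universal (`Scheme` is finitary extensive; Mathlib
  `IsUniversalColimit.isPullback_of_isColimit_left`).

Nothing in the assembly is specific to Cossart–Piltant; the file asserts nothing beyond what is
proved. `cor13_of_verbatim` records that the printed statement implies the tree's transcription.

## References

* V. Cossart, O. Piltant, J. Algebra 529 (2019) 268–535, Cor. 1.3. [CossartPiltant2019]
* The Stacks Project, Tag 033M. [StacksProject]
-/

universe u

open CategoryTheory CategoryTheory.Limits AlgebraicGeometry Opposite TopologicalSpace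

namespace Literature.AlgebraicGeometry.CossartPiltant200819.CP2019

open Literature.AlgebraicGeometry.Motives Literature.AlgebraicGeometry.Resolution

/-! ## Coproducts of schemes: points, regularity, `Sigma.map`, the codiagonal -/

section Coproducts

variable {ι : Type u}

/-- Every point of `∐ Xᵢ` is `Sigma.ι X i y` for some `i` and `y ∈ Xᵢ`. [folklore] -/
theorem exists_sigmaι_apply_eq (X : ι → Scheme.{u}) (x : ↥(∐ X)) :
    ∃ (i : ι) (y : X i), Sigma.ι X i y = x := by
  obtain ⟨⟨i, y⟩, rfl⟩ := (sigmaMk X).surjective x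
  exact ⟨i, y, (sigmaMk_mk X i y).symm⟩

/-- `Sigma.ι Y j z` lies in the image of `Sigma.ι Y i` iff `i = j`. [folklore] -/
theorem sigmaι_apply_mem_range_iff (Y : ι → Scheme.{u}) (i j : ι) (z : Y j) :
    Sigma.ι Y j z ∈ Set.range (Sigma.ι Y i) ↔ i = j := by
  constructor
  · rintro ⟨w, hw⟩
    exact congrArg Sigma.fst ((sigmaι_eq_iff Y i j w z).mp hw)
  · rintro rfl
    exact ⟨z, rfl⟩

/-- The square `Xᵢ → ∐ X`, `Yᵢ → ∐ Y` over `Limits.Sigma.map g` is cartesian. [folklore] -/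
theorem isPullback_sigmaι_map (X Y : ι → Scheme.{u}) (g : ∀ i, X i ⟶ Y i) (i : ι) :
    IsPullback (g i) (Sigma.ι X i) (Sigma.ι Y i) (Limits.Sigma.map g) := by
  refine IsOpenImmersion.isPullback _ _ _ _ (by simp) ?_
  ext x
  obtain ⟨j, y, rfl⟩ := exists_sigmaι_apply_eq X x
  change Sigma.ι X j y ∈ (Limits.Sigma.map g) ⁻¹' Set.range (Sigma.ι Y i) ↔
    Sigma.ι X j y ∈ Set.range (Sigma.ι X i)
  rw [Set.mem_preimage, ← Scheme.Hom.comp_apply, Sigma.ι_map, Scheme.Hom.comp_apply,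
    sigmaι_apply_mem_range_iff, sigmaι_apply_mem_range_iff]

/-- A property of morphisms that is Zariski-local at the target is inherited by `Sigma.map`.
[folklore] -/
theorem sigmaMap_of_isZariskiLocalAtTarget (P : MorphismProperty Scheme.{u})
    [IsZariskiLocalAtTarget P] {X Y : ι → Scheme.{u}} (g : ∀ i, X i ⟶ Y i)
    (hg : ∀ i, P (g i)) : P (Limits.Sigma.map g) := by
  have hcov : ⨆ i, (Sigma.ι Y i).opensRange = ⊤ := by
    rw [eq_top_iff]
    rintro x -
    obtain ⟨i, y, rfl⟩ := exists_sigmaι_apply_eq Y x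
    exact Opens.mem_iSup.mpr ⟨i, ⟨y, rfl⟩⟩
  refine IsZariskiLocalAtTarget.of_iSup_eq_top _ hcov fun i => ?_
  refine (P.arrow_mk_iso_iff (morphismRestrictOpensRange _ _)).mpr ?_
  have e : Arrow.mk (g i) ≅ Arrow.mk (pullback.snd (Limits.Sigma.map g) (Sigma.ι Y i)) :=
    Arrow.isoMk' (g i) (pullback.snd (Limits.Sigma.map g) (Sigma.ι Y i))
      (isPullback_sigmaι_map X Y g i).flip.isoPullback (Iso.refl _) (by simp)
  exact (P.arrow_mk_iso_iff e).mp (hg i)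

/-- The disjoint union of regular schemes is regular. [folklore] -/
theorem isRegular_sigma (X : ι → Scheme.{u}) (hX : ∀ i, Scheme.IsRegular (X i)) :
    Scheme.IsRegular (∐ X) := by
  intro x
  obtain ⟨i, y, rfl⟩ := exists_sigmaι_apply_eq X x
  haveI := hX i y
  exact IsRegularLocalRing.of_ringEquiv
    (asIso ((Sigma.ι X i).stalkMap y)).commRingCatIsoToRingEquiv.symm

/-- The codiagonal `∐ᵢ Spec R → Spec R` is `∐ᵢ Spec R ≅ Spec Rⁿ → Spec R`. [folklore] -/
theorem sigmaDesc_id_eq (R : Type u) [CommRing R] :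
    Sigma.desc (fun _ : ι => 𝟙 (Spec (.of R))) =
      sigmaSpec (fun _ : ι => CommRingCat.of R) ≫
        Spec.map (CommRingCat.ofHom (algebraMap R (ι → R))) := by
  refine Sigma.hom_ext _ _ fun i => ?_
  rw [Sigma.ι_desc, ι_sigmaSpec_assoc, ← Spec.map_comp, ← CommRingCat.ofHom_comp]
  have : (Pi.evalRingHom (fun _ : ι => R) i).comp (algebraMap R (ι → R)) = RingHom.id R := by
    ext r; simp
  rw [this, CommRingCat.ofHom_id]
  exact (Spec.map_id _).symm

variable [Finite ι]

/-- The codiagonal `∐ᵢ Spec R → Spec R` (finite `ι`) is finite. [folklore] -/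
theorem isFinite_sigmaDesc_id (R : Type u) [CommRing R] :
    IsFinite (Sigma.desc (fun _ : ι => 𝟙 (Spec (.of R)))) := by
  rw [sigmaDesc_id_eq]
  haveI : IsFinite (Spec.map (CommRingCat.ofHom (algebraMap R (ι → R)))) := by
    rw [IsFinite.SpecMap_iff]
    exact RingHom.finite_algebraMap.mpr inferInstance
  infer_instance

/-- A morphism `∐ᵢ Xᵢ → Spec R` (finite `ι`) is proper if every `Xᵢ → Spec R` is. [folklore] -/
theorem isProper_sigmaDesc {R : Type u} [CommRing R] {X : ι → Scheme.{u}}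
    (g : ∀ i, X i ⟶ Spec (.of R)) [∀ i, IsProper (g i)] : IsProper (Sigma.desc g) := by
  have heq : Sigma.desc g = Limits.Sigma.map g ≫ Sigma.desc (fun _ : ι => 𝟙 (Spec (.of R))) := by
    refine Sigma.hom_ext _ _ fun i => ?_
    rw [Sigma.ι_desc, Sigma.ι_map_assoc, Sigma.ι_desc, Category.comp_id]
  haveI : IsProper (Limits.Sigma.map g) :=
    sigmaMap_of_isZariskiLocalAtTarget @IsProper g (fun i => inferInstance)
  haveI := isFinite_sigmaDesc_id (ι := ι) R
  rw [heq]
  infer_instance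

end Coproducts

/-! ## The generic fibre of a disjoint union of models -/

section GenericFibre

variable {ι : Type u} [Finite ι] {O : Type u} [CommRing O] {F : Type u} [CommRing F] [Algebra O F]

/-- **Models of the pieces give a model of the disjoint union.** Let `T` be an `F`-scheme which is
the coproduct of open subschemes `Tᵢ` (a cofan of open immersions `cᵢ : Tᵢ → T` that is a
colimit), and let `𝒳ᵢ → Spec 𝒪` be schemes with `𝒳ᵢ ×_𝒪 F ≅ Tᵢ` over `F`. Then
`∐ 𝒳ᵢ → Spec 𝒪` has generic fibre `(∐ 𝒳ᵢ) ×_𝒪 F ≅ T` over `F`: coproducts in `Scheme` are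
universal (Mathlib: `Scheme` is `FinitaryExtensive`;
`IsUniversalColimit.isPullback_of_isColimit_left`). [folklore] -/
theorem nonempty_genericFibre_iso_of_isColimit (T : SchemeOver F) {P : ι → Scheme.{u}}
    (c : ∀ i, P i ⟶ T.left) (hc : IsColimit (Cofan.mk T.left c))
    (𝒳 : ι → Scheme.{u}) (g : ∀ i, 𝒳 i ⟶ Spec (.of O))
    (e : ∀ i, Over.mk (pullback.snd (g i) (Spec.map (CommRingCat.ofHom (algebraMap O F)))) ≅
      Over.mk (c i ≫ T.hom)) :
    Nonempty (Over.mk (pullback.snd (Sigma.desc g)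
      (Spec.map (CommRingCat.ofHom (algebraMap O F)))) ≅ T) := by
  set iF := Spec.map (CommRingCat.ofHom (algebraMap O F)) with hiF
  -- the coproduct cofan of the models is universal
  have hau : IsUniversalColimit (Cofan.mk (∐ 𝒳) (Sigma.ι 𝒳)) :=
    (FinitaryExtensive.isVanKampen_finiteCoproducts (coproductIsCoproduct 𝒳)).isUniversal
  -- the generic fibres of the models, as cartesian squares with vertex `P i`
  let e₁ : ∀ i, pullback (g i) iF ≅ P i := fun i => (Over.forget _).mapIso (e i)
  let q₂ : ∀ i, P i ⟶ 𝒳 i := fun i => (e₁ i).inv ≫ pullback.fst (g i) iF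
  have hw : ∀ i, (e₁ i).hom ≫ c i ≫ T.hom = pullback.snd (g i) iF := fun i => Over.w (e i).hom
  have hP : ∀ i, IsPullback (c i ≫ T.hom) (q₂ i) iF (g i) := by
    intro i
    refine (IsPullback.of_hasPullback (g i) iF).flip.of_iso (e₁ i)
      (Iso.refl _) (Iso.refl _) (Iso.refl _) ?_ (by simp [q₂]) (by simp) (by simp)
    rw [Iso.refl_hom, Category.comp_id]
    exact (hw i).symm
  have H := hau.isPullback_of_isColimit_left g (Sigma.desc g) iF (fun i => c i ≫ T.hom) q₂ hP hc
    (fun i => Sigma.ι_desc g i)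
  -- identify the descended maps
  have h1 : Cofan.IsColimit.desc hc (fun i => c i ≫ T.hom) = T.hom :=
    Cofan.IsColimit.hom_ext hc _ _ fun i => by rw [Cofan.IsColimit.fac]; rfl
  rw [h1] at H
  refine ⟨(Over.isoMk H.flip.isoPullback H.flip.isoPullback_hom_snd :
    T ≅ Over.mk (pullback.snd (Sigma.desc g) iF)).symm⟩

end GenericFibre

/-! ## A Noetherian regular scheme is the disjoint union of its irreducible components -/

section Components

variable {X : Scheme.{u}} [AlgebraicGeometry.IsNoetherian X] (hX : Scheme.IsRegular X)

/-- The (finite) index type of irreducible components of `X`. [folklore] -/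
abbrev Comp (X : Scheme.{u}) : Type u := ↥(irreducibleComponents (X : Type u))

/-- A Noetherian scheme has finitely many irreducible components (a theorem, not a global
instance). [folklore] -/
theorem finite_comp : Finite (Comp X) :=
  (NoetherianSpace.finite_irreducibleComponents (α := X)).to_subtype

/-- The irreducible component `C` of a Noetherian regular scheme, as an OPEN subscheme
(`Scheme.irreducibleComponentOpen`, whose underlying set is `C` by
`Scheme.IsRegular.coe_irreducibleComponentOpen`). [folklore] -/
noncomputable abbrev compOpen (C : Comp X) : X.Opens := X.irreducibleComponentOpen C.1

include hX in
/-- The underlying set of `compOpen C` is the component `C` (regularity is used: components of a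
regular scheme do not meet). [folklore] -/
theorem coe_compOpen (C : Comp X) : (compOpen C : Set X) = C.1 :=
  hX.coe_irreducibleComponentOpen C.2

include hX in
/-- The irreducible components cover. [folklore] -/
theorem iSup_opensRange_compOpen_ι : ⨆ C : Comp X, (compOpen C).ι.opensRange = ⊤ := by
  rw [eq_top_iff]
  rintro x -
  let C : Comp X := ⟨irreducibleComponent x, irreducibleComponent_mem_irreducibleComponents x⟩
  have hx : x ∈ (compOpen C : Set X) := by
    rw [coe_compOpen hX]
    exact mem_irreducibleComponent
  refine Opens.mem_iSup.mpr ⟨C, ?_⟩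
  rw [Scheme.Opens.opensRange_ι]
  exact hx

include hX in
/-- The irreducible components of a regular scheme are pairwise disjoint (Stacks Tag 033M for
normal Noetherian schemes; here via `Scheme.IsRegular.eq_of_mem_irreducibleComponents`).
[cite: StacksProject, Tag 033M] -/
theorem pairwise_disjoint_compOpen :
    Pairwise (Function.onFun Disjoint fun C : Comp X => (compOpen C).ι.opensRange) := by
  intro C C' hCC'
  simp only [Function.onFun, Scheme.Opens.opensRange_ι]
  rw [disjoint_iff, ← SetLike.coe_set_eq, Opens.coe_inf, coe_compOpen hX, coe_compOpen hX,
    Opens.coe_bot, Set.eq_empty_iff_forall_notMem]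
  rintro x ⟨hx, hx'⟩
  exact hCC' (Subtype.ext (hX.eq_of_mem_irreducibleComponents x C.2 C'.2 hx hx'))

include hX in
/-- A Noetherian regular scheme is the coproduct (finite disjoint union) of its irreducible
components: Stacks Tag 033M, "Let `X` be a Noetherian scheme. The following are equivalent:
(1) `X` is normal, and (2) `X` is a finite disjoint union of normal integral schemes", in the
regular case. [cite: StacksProject, Tag 033M] -/
theorem nonempty_isColimit_cofan_compOpen :
    Nonempty (IsColimit (Cofan.mk X fun C : Comp X => (compOpen C).ι)) :=
  nonempty_isColimit_cofanMk_of _ (iSup_opensRange_compOpen_ι hX) (pairwise_disjoint_compOpen hX)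

include hX in
/-- Each irreducible component (as an open subscheme) of a Noetherian regular scheme is an
integral scheme. [cite: StacksProject, Tag 033M] -/
theorem isIntegral_compOpen (C : Comp X) : IsIntegral (compOpen C : Scheme.{u}) := by
  haveI : IsReduced X := hX.isReduced
  have hirr : IsIrreducible (compOpen C : Set X) := by
    rw [coe_compOpen hX]; exact C.2.1
  haveI : IrreducibleSpace (compOpen C : Scheme.{u}) := Subtype.irreducibleSpace hirr
  exact isIntegral_of_irreducibleSpace_of_isReduced _

include hX in
/-- The inclusion of an irreducible component of a Noetherian regular scheme is a closed
immersion (its image, the component, is closed). [folklore] -/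
theorem isClosedImmersion_compOpen_ι (C : Comp X) : IsClosedImmersion (compOpen C).ι := by
  refine IsClosedImmersion.of_isPreimmersion _ ?_
  rw [Scheme.Opens.range_ι, coe_compOpen hX]
  exact isClosed_of_mem_irreducibleComponents C.1 C.2

omit [AlgebraicGeometry.IsNoetherian X] in
/-- The dimension of an open subscheme is at most that of the scheme. [folklore] -/
theorem topologicalKrullDim_opens_le (U : X.Opens) :
    topologicalKrullDim (U : Scheme.{u}) ≤ topologicalKrullDim X :=
  topologicalKrullDim_subspace_le X (U : Set X)

/-- A nonempty space has a natural-number Krull dimension as soon as it is bounded by one.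
[folklore] -/
theorem exists_nat_topologicalKrullDim_eq {Y : Type u} [TopologicalSpace Y] [Nonempty Y] {n : ℕ}
    (h : topologicalKrullDim Y ≤ n) : ∃ d : ℕ, topologicalKrullDim Y = d ∧ d ≤ n := by
  have h0 : 0 ≤ topologicalKrullDim Y := by
    obtain ⟨y⟩ := ‹Nonempty Y›
    haveI : Nonempty (IrreducibleCloseds Y) :=
      ⟨⟨closure {y}, isIrreducible_singleton.closure, isClosed_closure⟩⟩
    exact Order.krullDim_nonneg
  have hne : topologicalKrullDim Y ≠ ⊥ := by
    intro hb
    rw [hb] at h0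
    exact absurd h0 (by simp)
  obtain ⟨m, hm⟩ := WithBot.ne_bot_iff_exists.mp hne
  have hmn : m ≤ n := by
    rw [← hm] at h
    exact_mod_cast h
  have hmtop : m ≠ ⊤ := ne_top_of_le_ne_top (ENat.coe_ne_top n) hmn
  obtain ⟨d, rfl⟩ := ENat.ne_top_iff_exists.mp hmtop
  exact ⟨d, by rw [← hm]; rfl, by exact_mod_cast hmn⟩

end Components

/-! ## Corollary 1.3 as printed -/

section Cor13Verbatim

/-- **The regular model of a possibly disconnected regular projective `F`-scheme of dimension
`≤ 2`**, from Thm. 1.1: decompose into irreducible components (integral, regular, projective, of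
dimension `≤ 2`), take the models of `exists_regularModel_of_thm11`, and form their disjoint
union. [cite: CossartPiltant2019, Cor. 1.3; StacksProject, Tag 033M] -/
theorem exists_regularModel_of_regular_of_thm11 (h : CossartPiltant2019Thm11.{u})
    (O : Type u) [CommRing O] [IsDedekindDomain O] (hO : IsExcellentRing O)
    (F : Type u) [Field F] [Algebra O F] [IsFractionRing O F] (S : SchemeOver F)
    (hS : IsProjectiveOver S) (hreg : Scheme.IsRegular S.left)
    (hdim : topologicalKrullDim S.left ≤ 2) :
    ∃ (𝒳 : Scheme.{u}) (g : 𝒳 ⟶ Spec (.of O)), IsProper g ∧ Flat g ∧ Scheme.IsRegular 𝒳 ∧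
      Nonempty (Over.mk (pullback.snd g (Spec.map (CommRingCat.ofHom (algebraMap O F)))) ≅ S) := by
  classical
  set iF := Spec.map (CommRingCat.ofHom (algebraMap O F)) with hiF
  -- `S` is Noetherian
  haveI : IsProper S.hom := hS.isProper
  haveI : IsNoetherian S.left := by
    haveI : IsLocallyNoetherian S.left := LocallyOfFiniteType.isLocallyNoetherian S.hom
    haveI : CompactSpace S.left := QuasiCompact.compactSpace_of_compactSpace S.hom
    exact {}
  -- the components
  haveI : Finite (Comp S.left) := finite_comp
  let T : Comp S.left → SchemeOver F := fun C => Over.mk ((compOpen C).ι ≫ S.hom)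
  have hT : ∀ C, ∃ (𝒳 : Scheme.{u}) (g : 𝒳 ⟶ Spec (.of O)), IsProper g ∧ Flat g ∧
      Scheme.IsRegular 𝒳 ∧ Nonempty (Over.mk (pullback.snd g iF) ≅ T C) := by
    intro C
    haveI : IsIntegral (T C).left := isIntegral_compOpen hreg C
    have hregC' : Scheme.IsRegular (compOpen C : Scheme.{u}) :=
      hreg.of_isOpenImmersion (compOpen C).ι
    have hregC : Scheme.IsRegular (T C).left := hregC'
    have hprojC : IsProjectiveOver (T C) := by
      obtain ⟨N, ι, hι⟩ := hS
      haveI := hι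
      haveI := isClosedImmersion_compOpen_ι hreg C
      have w : ((compOpen C).ι ≫ ι.left) ≫ (projectiveSpace N F).hom = (T C).hom := by
        rw [Category.assoc, Over.w ι]; rfl
      refine ⟨N, Over.homMk (U := T C) (V := projectiveSpace N F) ((compOpen C).ι ≫ ι.left) w, ?_⟩
      show IsClosedImmersion ((compOpen C).ι ≫ ι.left)
      infer_instance
    haveI : Nonempty ((compOpen C : Scheme.{u}) : Type u) := by
      obtain ⟨x, hx⟩ := C.2.1.nonempty
      rw [← coe_compOpen hreg C] at hx
      exact ⟨⟨x, hx⟩⟩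
    obtain ⟨d, hd, hd2⟩ := exists_nat_topologicalKrullDim_eq
      ((topologicalKrullDim_opens_le (compOpen C)).trans hdim)
    exact exists_regularModel_of_thm11 h O hO F (T C) hprojC hregC hd hd2
  choose 𝒳 g hprop hflat hregX he using hT
  haveI := hprop
  haveI := hflat
  refine ⟨∐ 𝒳, Sigma.desc g, isProper_sigmaDesc g, inferInstance, isRegular_sigma 𝒳 hregX, ?_⟩
  obtain ⟨hc⟩ := nonempty_isColimit_cofan_compOpen hreg (X := S.left)
  exact nonempty_genericFibre_iso_of_isColimit S (fun C => (compOpen C).ι) hc 𝒳 g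
    (fun C => (he C).some)

/-- **Cossart–Piltant 2019, Cor. 1.3, verbatim, from Thm. 1.1** (arXiv:1412.0868v1 p. 3): "Let
`𝒪` be an excellent Dedekind domain with quotient field `F` and `Σ/F` be a regular projective
surface. There exists a proper and flat `𝒪`-scheme `𝒳` with generic fiber `𝒳_F = Σ` which is
everywhere regular." Compared with the tree's transcription `CossartPiltant2019Cor13` (derived in
`cor13_of_thm11`), the hypothesis `IsIntegral S.left` is dropped: `Σ = S` is any regular projective
`F`-scheme of dimension `2`, possibly disconnected. Derived from the transcription
`CossartPiltant2019Thm11` of Thm. 1.1 (hypothesis `h`).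
[cite: CossartPiltant2019, Cor. 1.3 (statement §1, arXiv:1412.0868v1 p. 3; proof §4.1, p. 52)] -/
theorem cor13Verbatim_of_thm11 (h : CossartPiltant2019Thm11.{u}) :
    ∀ (O : Type u) [CommRing O] [IsDedekindDomain O], IsExcellentRing O →
      ∀ (F : Type u) [Field F] [Algebra O F] [IsFractionRing O F] (S : SchemeOver F),
        IsProjectiveOver S → Scheme.IsRegular S.left → topologicalKrullDim S.left = 2 →
          ∃ (𝒳 : Scheme.{u}) (g : 𝒳 ⟶ Spec (.of O)), IsProper g ∧ Flat g ∧ Scheme.IsRegular 𝒳 ∧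
            Nonempty
              (Over.mk (pullback.snd g (Spec.map (CommRingCat.ofHom (algebraMap O F)))) ≅ S) := by
  intro O _ _ hO F _ _ _ S hS hreg hdim
  exact exists_regularModel_of_regular_of_thm11 h O hO F S hS hreg hdim.le

/-- The printed Cor. 1.3 (the statement proved in `cor13Verbatim_of_thm11`, here as hypothesis
`hv`) implies the tree's transcription `CossartPiltant2019Cor13`, which carries the extra
hypothesis `IsIntegral S.left`. [cite: CossartPiltant2019, Cor. 1.3] -/
theorem cor13_of_verbatim
    (hv : ∀ (O : Type u) [CommRing O] [IsDedekindDomain O], IsExcellentRing O →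
      ∀ (F : Type u) [Field F] [Algebra O F] [IsFractionRing O F] (S : SchemeOver F),
        IsProjectiveOver S → Scheme.IsRegular S.left → topologicalKrullDim S.left = 2 →
          ∃ (𝒳 : Scheme.{u}) (g : 𝒳 ⟶ Spec (.of O)), IsProper g ∧ Flat g ∧ Scheme.IsRegular 𝒳 ∧
            Nonempty
              (Over.mk (pullback.snd g (Spec.map (CommRingCat.ofHom (algebraMap O F)))) ≅ S)) :
    CossartPiltant2019Cor13.{u} := by
  intro O _ _ hO F _ _ _ S hS _ hreg hdim
  exact hv O hO F S hS hreg hdim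

end Cor13Verbatim

end Literature.AlgebraicGeometry.CossartPiltant200819.CP2019
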